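import Literature.NumberTheory.EllipticCurves.BSDRankZeroDensity
import HarnessLib

/-!
# Stability of congruence families under the twist by `-1` — the discharge of the hypothesis `_hstab`
# of `thm16_exists_rootNumber_twist_subfamily_of_twistStable` (proofs only)

Topic `NumberTheory/EllipticCurves`, story `BhargavaSkinnerZhang2014/`. Proofs-only sibling (no
definition, no named fact, no instance; D-0014 / D-0026) of `RootNumberTwistSubfamily.lean`, whose
cited-only fact `thm16_exists_rootNumber_twist_subfamily_of_twistStable` (registry A328, re-typed
2026-08-24 on REFEREE 2's ruling R2-146.1) carries the hypothesis
`(_hstab : ∀ AB, F.Mem AB → F.Mem (negB AB))` — the family `F` is stable under the quadratic twist by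
`-1`, `E_{A,B} ↦ E_{A,-B}` — which is exactly the setting in which Bhargava–Skinner–Zhang use the
[BS5] reading of their Theorem 16 (proof of Cor. 26, arXiv:1407.1826 §3.5; held text
`paper:arxiv-1407.1826` p0011 L84–L85: "since `S₁(5)` is stable under `−1`-twist, `F` also has the
property that for all `E ∈ F` the root number of `E` and its `−1`-twist are both in `F`").

This file supplies the ONE generic lemma every consumer family discharges that hypothesis with: a
congruence family (`CongruenceFamily` of `BSDRankZeroDensity.lean`: a modulus `p ^ expt p`, a residue
set at every prime, two sign permissions at infinity) whose residue sets are stable under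
`(a, b) ↦ (a, -b)` at every prime is stable under `negB` — because the height-family condition and the
discriminant `Δ(A, B) = -16(4A³ + 27B²)` are invariant under `B ↦ -B`. The sets the BSD-DENSITY
sprint presents as `F` — `S₀(5) = {5 ∤ A}` (BSZ Lemma 17), `S₁′(5)` (BSZ Lemma 18: the split /
non-split criterion `u⁴ ≡ -3A (mod 5)` is `B`-free), `T₅`, and the family of all curves — have residue
sets of this kind, so each discharges `_hstab` in one line (pub-bsdpct's C0 instantiation; the
all-curves case is proved below as the model instance).

CREDIT: the generic lemma and its proof are REFEREE 2's (referee-b2b-bsdres-ref-2, Gen 147, draft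
`HOME/b2b-bsdres-ref-2/g147/a328_retyping_draft.lean` clause (b), 2026-08-24), lifted verbatim by
the cell lead (lit GEN 118) into the tree on the referee desks' «no objection» (HOME INBOX l.16938 (1),
l.16922); nothing here is new mathematics.

## References

* [BhargavaSkinnerZhang2014] M. Bhargava, C. Skinner, W. Zhang, arXiv:1407.1826 (2014): §2.3
  (large families defined by congruence conditions), Lemmas 17–18 (§3.2), proof of Cor. 26 (§3.5).
* [BhargavaShankar5Selmer2013] M. Bhargava, A. Shankar, arXiv:1312.7859 (2013), §5 (p0017
  L111–L115: closure of the constructed families under `E ↦ E₋₁`).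
-/

noncomputable section

open scoped Classical

namespace Literature.NumberTheory.EllipticCurves

namespace CongruenceFamily

/-- **Generic discharge of the twist-stability hypothesis.** A congruence family whose residue set at
every prime is stable under `(a, b) ↦ (a, -b)` is stable under the twist by `-1`,
`negB : (A, B) ↦ (A, -B)`: membership `F.Mem` consists of the height-family condition (invariant,
`isInHeightFamily_negB`), the residue conditions (stable by hypothesis) and the two sign conditions on
`-(4A³ + 27B²)` (invariant under `B ↦ -B`). This is the form in which Bhargava–Skinner–Zhang use "`S`
is stable under `−1`-twist" for their sets defined by congruence conditions modulo powers of `5`.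
(Proof: REFEREE 2 Gen 147, draft clause (b), verbatim.)
[cite: BhargavaSkinnerZhang2014, proof of Cor. 26 (§3.5; held text p0011 L84–L85) and §2.3] -/
theorem mem_negB_of_residues_negB (F : CongruenceFamily)
    (hres : ∀ p : ℕ, p.Prime → ∀ x : ZMod (p ^ F.expt p) × ZMod (p ^ F.expt p),
      x ∈ F.residues p → (x.1, -x.2) ∈ F.residues p)
    {AB : ℤ × ℤ} (h : F.Mem AB) : F.Mem (negB AB) := by
  obtain ⟨hH, hp, hpos, hneg⟩ := h
  refine ⟨(isInHeightFamily_negB AB).mpr hH, ?_, ?_, ?_⟩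
  · intro p hp'
    have := hres p hp' _ (hp p hp')
    simpa [negB] using this
  · intro h0; apply hpos; simpa [negB, even_two, Even.neg_pow] using h0
  · intro h0; apply hneg; simpa [negB, even_two, Even.neg_pow] using h0

/-- The same as an `iff` (`negB` is an involution, `negB_negB`): under residue sets stable under
`(a, b) ↦ (a, -b)`, `E_{A,-B} ∈ F ↔ E_{A,B} ∈ F`.
[cite: BhargavaSkinnerZhang2014, proof of Cor. 26 (§3.5; held text p0011 L84–L85)] -/
theorem mem_negB_iff_of_residues_negB (F : CongruenceFamily)
    (hres : ∀ p : ℕ, p.Prime → ∀ x : ZMod (p ^ F.expt p) × ZMod (p ^ F.expt p),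
      x ∈ F.residues p → (x.1, -x.2) ∈ F.residues p)
    (AB : ℤ × ℤ) : F.Mem (negB AB) ↔ F.Mem AB := by
  refine ⟨fun h ↦ ?_, F.mem_negB_of_residues_negB hres⟩
  simpa only [negB_negB] using F.mem_negB_of_residues_negB hres h

/-- **Model instance: a family with no residue condition at all** (`F.residues p = Set.univ` at every
prime — e.g. the family of all curves `CongruenceFamily.mk (fun _ ↦ 0) (fun _ ↦ Set.univ) True True`
of `BSDAverageRankFiveSelmer.lean`, inside which [BS5] Thm. 6 builds its `F`) is stable under the
twist by `-1`, whatever its conditions at infinity. [cite: BhargavaShankar5Selmer2013, Thm. 6 and §5 (p0017 L111–L115)] -/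
theorem mem_negB_of_residues_eq_univ (F : CongruenceFamily)
    (huniv : ∀ p : ℕ, p.Prime → F.residues p = Set.univ) {AB : ℤ × ℤ} (h : F.Mem AB) :
    F.Mem (negB AB) :=
  F.mem_negB_of_residues_negB (fun p hp x _ ↦ by rw [huniv p hp]; exact Set.mem_univ _) h

end CongruenceFamily

end Literature.NumberTheory.EllipticCurves

end
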